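import Literature.MathematicalPhysics.QuantumFieldTheory.Balaban1983to89.B8Thm2TorusLettersTauOfKnit
import Literature.MathematicalPhysics.QuantumFieldTheory.Balaban1983to89.B8Thm2SetupTorusOfLettersPerB9

/-!
# `Balaban1983to89.B8Thm2SetupTorusOfMajorants` — M5.9 ASSEMBLY, FILE A6 (consumer glue): [Balaban1985RegularSpaces] Theorem 2 at the `SU(N)`-valued
# Setup-torus objects `Thm2SetupSUAt (PV d ℓ m K) N k η 0 B₁ B₂ c₁ len ⊤` — the currency of the R3 consumer on `stmt-QuantumFields-19200` — FROM the displayed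
# [Balaban1985BackgroundPropagators] Thm 3.1 ∕ 3.2-type block majorants at print's transporters, the (B)-lines and a member catalogue (files A1–A5 composed with
# `B8Thm2SetupTorus.thm2SetupSUAt_of_thm2TorusAt`)

statement-level skeleton of published theorems with citation tags; proofs where landed; nothing here is a claim about the
Yang–Mills mass gap

T. Bałaban, *Spaces of regular gauge field configurations on a lattice and gauge fixing conditions*, Commun. Math. Phys. **99** (1985) 75–102
[`Balaban1985RegularSpaces`, "[B8]"]: Thm 2 p. 83, (1.33)–(1.39) pp. 82–83, p. 77 (*«we admit the case where some domains Ω_j are equal to T_η»*), p. 76 (*«G = SU(N)»*),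
(1.91)–(1.98) pp. 91–92, (1.101) p. 93, (1.59) p. 86.  T. Bałaban, *Propagators for lattice gauge theories in a background field*, Commun. Math. Phys. **99** (1985)
389–434 [`Balaban1985BackgroundPropagators`, "[4]"]: Thm 3.1 (3.42) p. 397, Thm 3.2 (3.48) p. 398, (3.19)–(3.25) pp. 393–395.  T. Bałaban, *Averaging operations for
lattice gauge theories*, Commun. Math. Phys. **98** (1985) 17–51 [`Balaban1985Averaging`]: (4) p. 18 (the torus `T_η`, `L^k`-cubes tile it), Prop. 2 p. 26.
STATUS: published, refereed.

CITATION HEADER (lean-in-tree rule).  Cell `lit-balaban`, seat `lit-balaban-t2s-1` (gen 4), MODULE M5.9, file A6; sub-row G-B8-T2S (R3 `stmt-QuantumFields-19200`,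
helper; consumer `thm2SetupSUAt_of_thm2TorusAt → BirthV8.stub_PV3A`).  REUSED BY NAME: file A5 `thm2TorusAt_specialUnitary_ofMajorants_tr`; seat g3's consumer glue
pattern `B8Thm2SetupTorusOfLettersPerB9.thm2SetupSUAt_of_lettersPerB9` (`B8Thm2SetupTorus.thm2SetupSUAt_of_thm2TorusAt`, `pow_dvd_period`).

WHAT THIS FILE PROVES (sorry-free; no definitions; nothing of [B8]∕[4]'s estimates asserted).
* ★★★★★★ **`thm2SetupSUAt_ofMajorants_tr`** — for the global torus `PV d ℓ m K` (`d + 1 ≥ 2`, `L = ℓ + 1`), `1 ≤ N ≤ 25`: uniform `B₂, c₁ > 0` such that at every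
  level `1 ≤ k ≤ m + K` and every `η > 0`, GIVEN (i) a catalogue `memF k n` of constant-level-`n` members of the k-level family on the torus of side `sitesPerDir 0`,
  (ii) the [4] Thm 3.1∕3.2-type block majorants `KnitMajorants` (uniform `KnitConstants`) at every member and every `SU(N)`-valued periodic `U₀ ∈ 𝔄_n(T_η, α₀)`,
  `α₀ ≤ c_L`, (iii) the (B)-lines `B9P3PerAt` — `Thm2SetupSUAt (PV d ℓ m K) N k η 0 B₁ B₂ c₁ len (fun _ => True)` holds (endpoint windows on `B₀ … B₁`, `c_L` below
  [B7] Prop. 2's thresholds, `B_G, B₀′ᴴ, B₂′, B_R` above the four explicit expressions of file A4).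

HONEST SCOPE.  Glue only: (i)–(iii) are displayed hypotheses inhabited by nothing here (owners: def-Y carrier ∕ M5.5–M5.6 at `parKnitY` ∕ M5.7–M5.8); count-neutral;
N05 ∕ `stub_PV3A` NOT discharged; nothing continuum ∕ ℝ⁴ ∕ OS ∕ mass-gap ∕ Clay — the Yang–Mills mass gap is NOT proved.  No `sorry`, no `axiom`, no `… : Prop`
fact, no `instance`, no `notation`.  NEW file; nothing landed is modified.  Seat `lit-balaban-t2s-1` gen 4, 2026-08-28.
-/

noncomputable section

open scoped BigOperators

namespace Literature.MathematicalPhysics.QuantumFieldTheory.Balaban1983to89.B8Thm2SetupTorusOfMajorants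

open Node00 B6KLevelCensusIndexV1 B9Eq39Adjoint
open B7Prop1Explicit renaming Site → LSite
open B7Prop1Explicit (e)
open B7Prop2Explicit (C0 c2')
open B9Thm34Ext (toB6)
open B9GeoNormsKLevelV1 (geo9K)
open B8Ineq132 (InAk)
open B6GlobalChartV1 (PV)
open B8Thm2TorusLettersPerOfKnit (bgY)
open B8Thm2TorusKnitEstimatesOfMajorants (KnitConstants KnitMajorants B9P3PerAt)
open B8Thm2TorusLettersTauOfKnit (thm2TorusAt_specialUnitary_ofMajorants_tr)
open B7Prop2SpecialUnitary (specialUnitaryUnits)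
open B8Thm2SetupTorus (Thm2SetupSUAt thm2SetupSUAt_of_thm2TorusAt pow_dvd_period)
open scoped Matrix Matrix.Norms.L2Operator

variable {d ℓ : ℕ} {hd : 1 ≤ d + 1} {hL : Odd (ℓ + 1) ∧ 1 < ℓ + 1} {b₀ b₁ : ℝ}
variable {N : ℕ} [NeZero N]

/-- ★★★★★★ **[B8] THM 2 AT THE `SU(N)`-VALUED SETUP-TORUS OBJECTS OF `PV d ℓ m K`, FROM THE DISPLAYED BLOCK MAJORANTS, (B)-LINES AND MEMBER CATALOGUE** (`1 ≤ N ≤ 25`,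
`d + 1 ≥ 2`, `L = ℓ + 1`): ONE pair `B₂, c₁ > 0` such that at every level `1 ≤ k ≤ m + K` and every `η > 0`, for the period `P₀ = sitesPerDir 0` (`L^k ∣ P₀`,
`pow_dvd_period`): catalogue props (every `memF k n`, `1 ≤ n ≤ k`, lives on the torus of side `P₀` at constant level `n`) → block majorants at every member and
background of the class → (B)-lines → `Thm2SetupSUAt (PV d ℓ m K) N k η 0 B₁ B₂ c₁ len (fun _ => True)`.  Its Landau-gauge letters ARE [4]'s operators at print's
transporters (files A2–A5).  HONEST SCOPE: the three arrows' antecedents are displayed; the Yang–Mills mass gap is NOT proved.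
[cite: Balaban1985RegularSpaces, Thm 2 p.83, (1.33)–(1.39) pp.82–83, p.77 («Ω_j = T_η»), p.76 («G = SU(N)»), (1.91)–(1.98) pp.91–92, (1.101) p.93, (1.59) p.86; Balaban1985BackgroundPropagators, Thm 3.1 (3.42) p.397, Thm 3.2 (3.48) p.398, (3.19)–(3.25) pp.393–395; Balaban1985Averaging, (4) p.18, Prop. 2 p.26] -/
theorem thm2SetupSUAt_ofMajorants_tr (m K : ℕ) (hN : N ≤ 25) (hd2 : 2 ≤ d + 1)
    {B₀ B₀' B₀'H B₂' BG BR B₀β cB9 β cL B₁ : ℝ} {len : LSite (d + 1) → ℝ}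
    (hB₀ : 0 < B₀) (hB₀' : 0 < B₀') (hB : 2 ≤ 5 * ((d + 1 : ℕ) : ℝ) * ((ℓ + 1 : ℕ) : ℝ) * B₀) (hB₀'H : 0 < B₀'H) (hB₂' : 0 ≤ B₂') (hBG : 0 ≤ BG)
    (hBR : 0 ≤ BR) (hcB9 : 0 < cB9) (hcL : 0 < cL) (hfree : 3 * (2 * ((d + 1 : ℕ) : ℝ) * (((ℓ + 1 : ℕ) : ℝ)) ^ 2) * BG * (BR + 2) ≤ B₀')
    (hB₁ : 5 * ((d + 1 : ℕ) : ℝ) * ((ℓ + 1 : ℕ) : ℝ) * B₀ * (1 + 11 * (((d + 1 : ℕ) : ℝ)) ^ 2) < B₁)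
    (hc3 : C0 (d + 1) * cL ≤ 1 / 3) (hc2 : 2 * cL ≤ c2' (d + 1) (ℓ + 1))
    {ι : Type} [Fintype ι] {b : Module.Basis ι ℝ (Matrix (Fin N) (Fin N) ℂ)} {M₂ δ₀ δ βx ρ A A₁ Kc c : ℝ} {d₁ : ℕ}
    (cst : KnitConstants b M₂ δ₀ δ βx ρ A A₁ Kc)
    (hBGe : (∑ j, ‖b j‖) * A * c * M₂ ≤ BG) (hBG₁ : (∑ j, ‖b j‖) * A₁ * c * M₂ ≤ BG)
    (hBH : (∑ j, ‖b j‖) * (((M₂ * ∑ j, ‖b j‖) * A * A * Kc * B6.c1 d₁ δ₀ βx ^ 2) * c * M₂) ≤ B₀'H)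
    (hBH₁ : (∑ j, ‖b j‖) * (((M₂ * ∑ j, ‖b j‖) * A₁ * A * Kc * B6.c1 d₁ δ₀ βx ^ 2) * c * M₂) ≤ B₀'H)
    (hB₂ : (∑ j, ‖b j‖) * (((M₂ * ∑ j, ‖b j‖) * A * Kc * B6.c1 d₁ δ₀ βx) * c * M₂)
        + (∑ j, ‖b j‖) * (((M₂ * ∑ j, ‖b j‖) * A * A * Kc * B6.c1 d₁ δ₀ βx ^ 2) * c * M₂) ≤ B₂')
    (hBRe : 1 + (∑ j, ‖b j‖) * (((M₂ * ∑ j, ‖b j‖) ^ 2 * A * Kc * A * B6.c1 d₁ δ₀ βx ^ 2) * c * M₂) ≤ BR)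
    (memF : ℕ → ℕ → KIdx d ℓ hd hL b₀ b₁) [∀ k n, Fintype (geo9K (memF k n)).Site] [∀ k n, DecidableEq (geo9K (memF k n)).Site]
    (ιBF : ∀ k n, BlkY (memF k n) → IBondY (memF k n)) (Rr : ℝ) (Hp : Prop) (sF : ℕ → ℕ → ℝ) :
    letI : CStarAlgebra (Matrix (Fin N) (Fin N) ℂ) := {}
    ∃ B₂ c₁ : ℝ, 0 < B₂ ∧ 0 < c₁ ∧ ∀ (k : ℕ) (η : ℝ), 1 ≤ k → k ≤ m + K → 0 < η →
      (∀ n, 1 ≤ n → n ≤ k → (((PV d ℓ (memF k n).m (memF k n).K hd hL).sitesPerDir 0 : ℕ) : ℤ) = (((PV d ℓ m K hd hL).sitesPerDir 0 : ℕ) : ℤ)) →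
      (∀ n, 1 ≤ n → n ≤ k → ∀ z : SiteY (memF k n), levY (memF k n) z = n) →
      (∀ n, 1 ≤ n → n ≤ k → ∀ ⦃α₀ : ℝ⦄, 0 < α₀ → α₀ ≤ cL → ∀ U₀ : LSite (d + 1) → Fin (d + 1) → (Matrix (Fin N) (Fin N) ℂ)ˣ,
          (∀ x κ, U₀ x κ ∈ specialUnitaryUnits (Fin N)) →
          (∀ (x : LSite (d + 1)) (μ : Fin (d + 1)), U₀ (x + (((PV d ℓ m K hd hL).sitesPerDir 0 : ℕ) : ℤ) • e μ) = U₀ x) →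
          InAk (ℓ + 1) n η α₀ (fun _ => (Set.univ : Set (LSite (d + 1)))) U₀ →
          KnitMajorants (memF k n) (bgY (memF k n) U₀) b (ιBF k n) Rr Hp d₁ δ₀ δ βx ρ A A₁ Kc c (sF k n)) →
      (∀ m', m' ≤ k → ∀ ⦃α₀ : ℝ⦄, 0 < α₀ → α₀ ≤ cL → ∀ U₀ : LSite (d + 1) → Fin (d + 1) → (Matrix (Fin N) (Fin N) ℂ)ˣ,
          (∀ x κ, U₀ x κ ∈ specialUnitaryUnits (Fin N)) →
          (∀ (x : LSite (d + 1)) (μ : Fin (d + 1)), U₀ (x + (((PV d ℓ m K hd hL).sitesPerDir 0 : ℕ) : ℤ) • e μ) = U₀ x) →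
          InAk (ℓ + 1) m' η α₀ (fun _ => (Set.univ : Set (LSite (d + 1)))) U₀ →
          B9P3PerAt (𝔸 := Matrix (Fin N) (Fin N) ℂ) (ℓ + 1) B₀ B₀β cB9 β len η m' α₀ (((PV d ℓ m K hd hL).sitesPerDir 0 : ℕ) : ℤ) U₀) →
      Thm2SetupSUAt (PV d ℓ m K hd hL) N k η 0 B₁ B₂ c₁ len (fun _ => True) := by
  letI : CStarAlgebra (Matrix (Fin N) (Fin N) ℂ) := {}
  obtain ⟨B₂, c₁, hB₂pos, hc₁, H⟩ :=
    thm2TorusAt_specialUnitary_ofMajorants_tr (len := len) hN hd2 hB₀ hB₀' hB hB₀'H hB₂' hBG hBR hcB9 hcL hfree hB₁ hc3 hc2 cst hBGe hBG₁ hBH hBH₁ hB₂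
      hBRe (fun k (_ : ℤ) n => memF k n) (fun k _ n => ιBF k n) Rr Hp (fun k _ n => sF k n)
  refine ⟨B₂, c₁, hB₂pos, hc₁, fun k η hk hkK hη hP hlev hmaj hb9 => thm2SetupSUAt_of_thm2TorusAt ?_⟩
  exact H k _ η hk hη (pow_dvd_period (PV d ℓ m K hd hL) (j := 0) (by simpa using hkK)) hP hlev hmaj hb9

end Literature.MathematicalPhysics.QuantumFieldTheory.Balaban1983to89.B8Thm2SetupTorusOfMajorants

end
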